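import Literature.AnabelianGeometry.EtaleTheta.RealificationExtensionWeak
import Literature.AnabelianGeometry.EtaleTheta.SubmonoidPerfection
import Literature.AnabelianGeometry.EtaleTheta.RSupportedMonoids

/-!
# [EtTh] Lemma 3.5 (i)(ii), `P^rlf` portion, DISCHARGED for WEAKLY perf-factorial `P` with cofinal `P^pf`

Source: S. Mochizuki, *The étale theta function …* [MochizukiEtTh2009], Lemma 3.5, PDF pp. 75–76
(printed 301–302): "Let `P`, `Q` be perf-factorial monoids such that: (a) `P` is a submonoid of `Q`;
(b) `P` is group-saturated in `Q`; (c) `ℝ` supports `Q`. Then: (i) The inclusion `P ↪ Q` extends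
uniquely to inclusions `P^pf ↪ Q`, `P^rlf ↪ Q`. (ii) Relative to the inclusions of (i), `P^pf`, `P^rlf`
are group-saturated in `Q`."

Weak-hypothesis twin of `Discharge/Sec3Lemma35Rlf.lean` (same seat): `P` is only WEAKLY perf-factorial
([FrdI] Def. 2.4 (i) (a)(b)(c) + (d_ord) + (d_res) — the abc-iut cell's repair of finding F-L2d2-1;
`Frobenioids/PerfFactorialWeak.lean`), `P^rlf` is `IsPerfFactorialWeak.Rlf`, and the printed step "for
every `a ∈ P^rlf`, there exists an `a' ∈ P^pf` such that `a' ≥ a`" (p. 75) is the explicit hypothesis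
`hcof` (it does not follow from the weak notion, and Lemma 3.5 (i) fails without it — finding F-L2d2-2).
No other hypothesis beyond the printed ones (`Supports Q .R`, `IsGroupSaturated P`).

* `existsUnique_rlf_extension`, `rlf_extension_dvd_iff`, `rlf_extension_injective`,
  `isGroupSaturated_mrange_rlf_extension` — for `hP.Rlf`, `hP : IsPerfFactorialWeak P`;
* `rlf_extension_via`, `isGroupSaturated_rlf_extension_via` — transported to any `ρ : P → R ≅ P^rlf`;
* the printed (perf-factorial) case is the instance `hP.weak` + `RlfCoordWeak.rlf_cofinal_of_isPerfFactorial`.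

The `P^pf` portion is `SubmonoidPerfection.lean` (seat abc-iut-L6-t12), unchanged. Proof-only (no
definitions). Seat abc-iut-L2-d2 (cell abc-iut, F-L2d2-1 repair chain, node EtTh:Lem3.5 rlf portion).
HONEST FRAMING: classical monoid algebra; nothing here bears on [IUTchIII] Cor. 3.12.
-/

namespace Literature.AnabelianGeometry.EtaleTheta

namespace Lemma35Weak

open Literature.AlgebraicGeometry.Frobenioids Function

universe u

variable {Q : Type u} [CommMonoid Q] (P : Submonoid Q)

/-! ### Lemma 3.5 (i), (ii) for the weak `P^rlf`, under cofinality of `P^pf` -/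

/-- **Lemma 3.5 (i), `P^rlf` portion — existence and uniqueness** (pp. 75–76), weak form: if `ℝ` supports
`Q`, the submonoid `P ⊆ Q` is WEAKLY perf-factorial and `P^pf` is cofinal in `P^rlf` (`hcof`, p. 75 "for
every `a ∈ P^rlf`, there exists an `a' ∈ P^pf` such that `a' ≥ a`"), the inclusion `P ↪ Q` extends
UNIQUELY, through `P → P^pf → P^rlf`, to a homomorphism of monoids `P^rlf → Q`.
[cite: MochizukiEtTh2009, Lem 3.5 p.75] -/
theorem existsUnique_rlf_extension (hR : Supports Q MonoidType.R) (hP : IsPerfFactorialWeak P)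
    (hcof : ∀ x : hP.Rlf, ∃ b : Perfection P, x ∣ hP.toRealification b) :
    ∃! φ : hP.Rlf →* Q, φ.comp (hP.toRealification.comp (Perfection.of P)) = P.subtype := by
  have hQ : IsPerfect Q := hR.1
  obtain ⟨ι, hι⟩ := Lemma35.exists_extension P hQ
  obtain ⟨φ, hφ⟩ := exists_rlf_hom_comp_eq hP hcof (RlfCoordWeak.isMonoprime_pfAt hP) ι hR
  refine ⟨φ, ?_, fun ψ hψ => ?_⟩
  · show φ.comp (hP.toRealification.comp (Perfection.of P)) = P.subtype
    rw [← MonoidHom.comp_assoc, hφ, hι]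
  · have hψι : ψ.comp hP.toRealification = ι :=
      Lemma35.extension_unique hQ _ _ (by rw [MonoidHom.comp_assoc]; exact hψ) hι
    exact rlf_hom_ext hP hcof (RlfCoordWeak.isMonoprime_pfAt hP) ι hR ψ φ hψι hφ

/-- **Lemma 3.5 (i), `P^rlf` portion — order embedding** (p. 76), weak form: with `P` moreover
group-saturated in `Q`, every extension `φ : P^rlf → Q` of the inclusion reflects and preserves `≤`.
[cite: MochizukiEtTh2009, Lem 3.5 p.76] -/
theorem rlf_extension_dvd_iff (hR : Supports Q MonoidType.R) (hP : IsPerfFactorialWeak P)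
    (hcof : ∀ x : hP.Rlf, ∃ b : Perfection P, x ∣ hP.toRealification b)
    (hsat : IsGroupSaturated P)
    (φ : hP.Rlf →* Q) (hφ : φ.comp (hP.toRealification.comp (Perfection.of P)) = P.subtype)
    (x y : hP.Rlf) : φ x ∣ φ y ↔ x ∣ y := by
  have hQ : IsPerfect Q := hR.1
  refine ⟨fun h => ?_, map_dvd φ⟩
  have hι : (φ.comp hP.toRealification).comp (Perfection.of P) = P.subtype := by
    rw [MonoidHom.comp_assoc]; exact hφ
  exact dvd_of_rlf_hom_dvd hP hcof (RlfCoordWeak.isMonoprime_pfAt hP) (φ.comp hP.toRealification)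
    (Lemma35.extension_injective _ hι) (Lemma35.isGroupSaturated_mrange_extension hQ hsat _ hι) φ rfl h

/-- **Lemma 3.5 (i), `P^rlf` portion — injectivity** (p. 76), weak form: "Thus, we conclude that `φ` is
injective" — for `P` group-saturated in `Q` (the crucial hypothesis, cf. Remark 3.5.2), every extension
`φ : P^rlf → Q` of the inclusion is injective. [cite: MochizukiEtTh2009, Lem 3.5 p.76] -/
theorem rlf_extension_injective (hR : Supports Q MonoidType.R) (hP : IsPerfFactorialWeak P)
    (hcof : ∀ x : hP.Rlf, ∃ b : Perfection P, x ∣ hP.toRealification b)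
    (hsat : IsGroupSaturated P)
    (φ : hP.Rlf →* Q) (hφ : φ.comp (hP.toRealification.comp (Perfection.of P)) = P.subtype) :
    Injective φ := fun x y h =>
  RlfCoordWeak.dvd_antisymm hP (RlfCoordWeak.isMonoprime_pfAt hP)
    ((rlf_extension_dvd_iff P hR hP hcof hsat φ hφ x y).mp h.dvd)
    ((rlf_extension_dvd_iff P hR hP hcof hsat φ hφ y x).mp h.symm.dvd)

/-- **Lemma 3.5 (ii), `P^rlf` portion** (p. 75), weak form: "Relative to the inclusions of (i), …
`P^rlf` [is] group-saturated in `Q`" — for `P` group-saturated in `Q` with `ℝ` supporting `Q`.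
[cite: MochizukiEtTh2009, Lem 3.5 p.75] -/
theorem isGroupSaturated_mrange_rlf_extension (hR : Supports Q MonoidType.R) (hP : IsPerfFactorialWeak P)
    (hcof : ∀ x : hP.Rlf, ∃ b : Perfection P, x ∣ hP.toRealification b)
    (hsat : IsGroupSaturated P)
    (φ : hP.Rlf →* Q) (hφ : φ.comp (hP.toRealification.comp (Perfection.of P)) = P.subtype) :
    IsGroupSaturated (MonoidHom.mrange φ) := by
  rw [isGroupSaturated_iff']
  rintro q _ ⟨x, rfl⟩ _ ⟨y, rfl⟩ h
  have hyx : y ∣ x := (rlf_extension_dvd_iff P hR hP hcof hsat φ hφ y x).mp ⟨q, by rw [mul_comm]; exact h.symm⟩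
  obtain ⟨z, rfl⟩ := hyx
  refine ⟨z, RSupported.mul_left_cancel hR (x := φ y) ?_⟩
  rw [← map_mul, ← h, mul_comm]


/-! ### Transport to any realification `ρ : P → R ≅ P^rlf` -/

/-- Extensions along `ρ : P → R` correspond to extensions along `P → P^pf → P^rlf` when `e : R ≅ P^rlf`
identifies `ρ` with the natural map. [cite: MochizukiEtTh2009, Lem 3.5 p.75] -/
private theorem comp_eq_subtype_iff (hP : IsPerfFactorialWeak P) {R : Type u} [CommMonoid R] (ρ : P →* R)
    (e : R ≃* hP.Rlf) (he : ∀ m : P, e (ρ m) = hP.toRealification (Perfection.of P m)) (ι : R →* Q) :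
    ι.comp ρ = P.subtype ↔
      (ι.comp e.symm.toMonoidHom).comp (hP.toRealification.comp (Perfection.of P)) = P.subtype := by
  constructor
  · intro h
    ext m
    show ι (e.symm (hP.toRealification (Perfection.of P m))) = m
    rw [← he m, MulEquiv.symm_apply_apply]
    exact DFunLike.congr_fun h m
  · intro h
    ext m
    have := DFunLike.congr_fun h m
    simp only [MonoidHom.comp_apply, MulEquiv.coe_toMonoidHom] at this
    rw [← he m, MulEquiv.symm_apply_apply] at this
    exact this

/-- **Lemma 3.5 (i), `P^rlf` portion, for any realification** (pp. 75–76): if `ρ : P → R` exhibits `R`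
as the (weak) realification of the weakly perf-factorial, group-saturated submonoid `P` of `Q` (`ℝ`
supporting `Q`, `P^pf` cofinal in `P^rlf`), the inclusion `P ↪ Q` extends UNIQUELY along `ρ` to `R → Q`,
and every such extension is INJECTIVE.
[cite: MochizukiEtTh2009, Lem 3.5 p.75] -/
theorem rlf_extension_via (hP : IsPerfFactorialWeak P)
    (hcof : ∀ x : hP.Rlf, ∃ b : Perfection P, x ∣ hP.toRealification b) (hsat : IsGroupSaturated P)
    (hR : Supports Q MonoidType.R) (R : Type u) [CommMonoid R] (ρ : P →* R) (e : R ≃* hP.Rlf)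
    (he : ∀ m : P, e (ρ m) = hP.toRealification (Perfection.of P m)) :
    (∃! ι : R →* Q, ι.comp ρ = P.subtype) ∧ ∀ ι : R →* Q, ι.comp ρ = P.subtype → Injective ι := by
  obtain ⟨φ, hφ, huniq⟩ := existsUnique_rlf_extension P hR hP hcof
  refine ⟨⟨φ.comp e.toMonoidHom, ?_, fun ι hι => ?_⟩, fun ι hι => ?_⟩
  · ext m
    show φ (e (ρ m)) = m
    rw [he m]
    exact DFunLike.congr_fun hφ m
  · have h1 := huniq (ι.comp e.symm.toMonoidHom) ((comp_eq_subtype_iff P hP ρ e he ι).mp hι)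
    ext r
    have := DFunLike.congr_fun h1 (e r)
    simp only [MonoidHom.comp_apply, MulEquiv.coe_toMonoidHom, MulEquiv.symm_apply_apply] at this
    rw [MonoidHom.comp_apply, MulEquiv.coe_toMonoidHom, ← this]
  · have hinj := rlf_extension_injective P hR hP hcof hsat _ ((comp_eq_subtype_iff P hP ρ e he ι).mp hι)
    intro r r' hrr'
    apply e.injective
    apply hinj
    simpa only [MonoidHom.comp_apply, MulEquiv.coe_toMonoidHom, MulEquiv.symm_apply_apply] using hrr'

/-- **Lemma 3.5 (ii), `P^rlf` portion, for any realification** (p. 75), weak form: every extension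
`R → Q` of the inclusion along a (weak) realification `ρ : P → R` has group-saturated image in `Q`.
[cite: MochizukiEtTh2009, Lem 3.5 p.75] -/
theorem isGroupSaturated_rlf_extension_via (hP : IsPerfFactorialWeak P)
    (hcof : ∀ x : hP.Rlf, ∃ b : Perfection P, x ∣ hP.toRealification b) (hsat : IsGroupSaturated P)
    (hR : Supports Q MonoidType.R) (R : Type u) [CommMonoid R] (ρ : P →* R) (e : R ≃* hP.Rlf)
    (he : ∀ m : P, e (ρ m) = hP.toRealification (Perfection.of P m)) (ι : R →* Q)
    (hι : ι.comp ρ = P.subtype) : IsGroupSaturated (MonoidHom.mrange ι) := by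
  have hsatR := isGroupSaturated_mrange_rlf_extension P hR hP hcof hsat _
    ((comp_eq_subtype_iff P hP ρ e he ι).mp hι)
  have hr : MonoidHom.mrange (ι.comp e.symm.toMonoidHom) = MonoidHom.mrange ι := by
    apply le_antisymm
    · rintro _ ⟨x, rfl⟩
      exact ⟨e.symm x, rfl⟩
    · rintro _ ⟨r, rfl⟩
      exact ⟨e r, by simp only [MonoidHom.comp_apply, MulEquiv.coe_toMonoidHom, MulEquiv.symm_apply_apply]⟩
  rwa [hr] at hsatR


/-! ### The printed hypotheses are a special case

For a perf-factorial `P` (printed Def. 2.4 (i)(d)) the cofinality hypothesis is automatic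
(`RlfCoordWeak.rlf_cofinal_of_isPerfFactorial`) and `hP.weak.Rlf` IS the tree's `hP.Rlf` (same carrier,
`RlfCoordWeak.realification_weak_eq`), so `existsUnique_rlf_extension P hR hP.weak
(RlfCoordWeak.rlf_cofinal_of_isPerfFactorial hP)` has — definitionally — the statement of the landed
`Lemma35.existsUnique_rlf_extension P hR hP`: the weak engine subsumes the printed one (not restated here,
dedup). -/

end Lemma35Weak

end Literature.AnabelianGeometry.EtaleTheta
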